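import Summits.HodgeConjecture.HodgeConjecture.Theorems.PadicSemiregularLiftHodgeFermatVarietiesPairedOfLargePrimesNull
import Literature.AlgebraicGeometry.HodgeTheory.FermatHodgeCharacterGlobal
import Mathlib.RingTheory.ZMod.UnitsCyclic
import Mathlib.NumberTheory.DirichletCharacter.Bounds
import HarnessLib

/-!
# Short character-sum configurations, III: functions on a sign orbit; the prime level

Crux `HodgeFermatVarieties` (stmt-HodgeConjecture-1334), line `cancel-by-any-claim-lattice`, stub S6
`stub_pairedOfLargePrimes` (lead c2) — tools for the BOUNDARY PRIME of the pairing theorem (the case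
`p = 2r + 3` left open by `…PairedOfLargePrimes`), where a Hodge character may have as many entries as
there are non-zero residues mod `p` and the counting of `even_of_oddNull` has no room.

* `units_sq_eq_one_primePow` — the square roots of `1` in `(ℤ/pᵉ)ˣ`, `p` odd, are `±1` (the unit group
  is cyclic).
* `even_of_oddNull_prime` — at a PRIME level no support bound is needed: a function on `ℤ/p` supported
  on units and annihilated by every odd (primitive = non-trivial) character is even.
* `orbit_sign` — the SIGN-ORBIT LEMMA: let every prime factor of `n` be `≥ 5`, `τ = ±1`, and let
  `H : ℤ/n → ℂ` be supported on one orbit `A·E` of the elementary `2`-group `E = {u : u² = 1}` of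
  `(ℤ/n)ˣ` (the local signs) and orthogonal to every PRIMITIVE character `χ` mod `n` with `χ(-1) = τ`.
  Then `H(-b) = -τ·H(b)`. (Induction over the prime powers `q ∥ n`: the sum and the difference of the
  two slices over `±(A mod q)` are orthogonal to the primitive characters mod `n/q` of parity `τ`
  resp. `-τ`, because primitive characters of both parities exist mod `q`.)

Everything here is proved; no named facts.

References: [Aoki1983] N. Aoki, Math. Ann. 266 (1983) 23–54, §3 (p. 28: `PC±(f) ≠ ∅`) and §9.
-/

set_option linter.dupNamespace false

noncomputable section

open Finset
open Literature.AlgebraicGeometry.HodgeTheory Literature.AlgebraicGeometry.HodgeTheory.FermatCharacter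

namespace Summit.HodgeConjecture.HodgeConjecture.Theorems.CancelByAnyClaimLattice

namespace PairedNull

/-! ### Square roots of one modulo an odd prime power -/

/-- **In `(ℤ/pᵉ)ˣ`, `p` an odd prime, `u² = 1` forces `u = ±1`**: the unit group is cyclic
(`ZMod.isCyclic_units_of_prime_pow`), so `x² = 1` has at most two solutions, and `1 ≠ -1`.
[folklore] -/
theorem units_sq_eq_one_primePow {p e : ℕ} (hp : p.Prime) (hp2 : p ≠ 2) (he : 1 ≤ e)
    (u : (ZMod (p ^ e))ˣ) (hu : u * u = 1) : u = 1 ∨ u = -1 := by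
  classical
  haveI : NeZero (p ^ e) := ⟨pow_ne_zero e hp.ne_zero⟩
  haveI : IsCyclic (ZMod (p ^ e))ˣ := ZMod.isCyclic_units_of_prime_pow p hp hp2 e
  have hp3 : 3 ≤ p := by
    rcases Nat.lt_or_ge p 3 with h | h
    · interval_cases p <;> simp_all [Nat.prime_def_lt]
    · exact h
  have hq3 : 2 < p ^ e := lt_of_lt_of_le (by omega) (Nat.le_self_pow (by omega) p)
  haveI : Fact (2 < p ^ e) := ⟨hq3⟩
  have hne : (1 : (ZMod (p ^ e))ˣ) ≠ -1 := by
    intro h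
    have := congrArg (fun z : (ZMod (p ^ e))ˣ ↦ (z : ZMod (p ^ e))) h
    simp only [Units.val_one, Units.val_neg] at this
    exact ZMod.neg_one_ne_one this.symm
  by_contra hcon
  rw [not_or] at hcon
  have hcard := IsCyclic.card_pow_eq_one_le (α := (ZMod (p ^ e))ˣ) (n := 2) Nat.two_pos
  have hsub : ({1, -1, u} : Finset (ZMod (p ^ e))ˣ) ⊆ univ.filter fun a : (ZMod (p ^ e))ˣ ↦ a ^ 2 = 1 := by
    intro a ha
    simp only [mem_insert, mem_singleton] at ha
    rw [mem_filter]
    refine ⟨mem_univ _, ?_⟩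
    rcases ha with rfl | rfl | rfl
    · rw [one_pow]
    · rw [neg_one_sq]
    · rw [sq, hu]
  have h3 : #({1, -1, u} : Finset (ZMod (p ^ e))ˣ) = 3 := by
    rw [card_insert_of_notMem, card_pair (Ne.symm hcon.2)]
    simp only [mem_insert, mem_singleton, not_or]
    exact ⟨hne, Ne.symm hcon.1⟩
  have := card_le_card hsub
  omega

/-! ### The prime level: odd-annihilated functions are even, with no support condition -/

/-- **At a prime level `p`, a function annihilated by every odd primitive character is even on units**
(all non-trivial characters mod `p` are primitive; the local Fourier lemma with `d = 1` makes
`x ↦ T(x) - T(-x)` constant on units, and an odd constant vanishes). [cite: Ran1980, Prop. 1.8 (i)] -/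
theorem even_of_oddNull_prime {p : ℕ} [NeZero p] (hp : p.Prime) (T : ZMod p → ℂ)
    (hTu : ∀ x, ¬ IsUnit x → T x = 0)
    (hT : ∀ χ : DirichletCharacter ℂ p, χ.Odd → χ.IsPrimitive → ∑ x : ZMod p, T x * χ x = 0)
    (x : ZMod p) : T (-x) = T x := by
  classical
  by_cases hx : IsUnit x
  swap
  · rw [hTu x hx, hTu (-x) (fun h ↦ hx (by simpa using h.neg))]
  have horth : ∀ χ : DirichletCharacter ℂ p, χ (-1) = -1 → ¬ χ.FactorsThrough 1 →
      ∑ y : ZMod p, T y * χ y = 0 :=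
    fun χ hχ hf ↦ hT χ hχ (isPrimitive_of_not_factorsThrough_one_prime hp χ hf)
  -- `G(y) = T(y) - T(-y)` is constant on units (kernel to level `1` = all units)
  have hG : ∀ u y : (ZMod p)ˣ, T ((u : ZMod p) * y) + (-1) * T (-((u : ZMod p) * y)) =
      T y + (-1) * T (-(y : ZMod p)) :=
    fun u y ↦ parityPart_mul_eq_of_orthogonal (one_dvd p) T (Or.inr rfl) horth u y
      (Subsingleton.elim (α := (ZMod 1)ˣ) _ _)
  have h1 := hG (-1) hx.unit
  have h2 := hG (hx.unit) 1
  simp only [Units.val_neg, Units.val_one, neg_one_mul, neg_neg, mul_one, IsUnit.unit_spec] at h1 h2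
  -- `h1 : T(-x) - T(x) = T(x) - T(-x)`
  linear_combination h1 / 2

/-! ### Functions on a sign orbit -/

/-- **The sign-orbit lemma.** Let every prime factor of `n` be `≥ 5`, `τ ∈ {1, -1}`, `A` a unit mod
`n`, and `H : ℤ/n → ℂ` supported on the orbit `{u·A : u² = 1}` of the local-sign group and
orthogonal to every primitive character `χ` mod `n` with `χ(-1) = τ`. Then `H(-b) = -τ·H(b)` for
every `b`. [cite: Aoki1983, §3 (p. 28) and §9] -/
theorem orbit_sign : ∀ (n : ℕ) [NeZero n], (∀ p ∈ n.primeFactors, 5 ≤ p) →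
    ∀ (τ : ℂ), (τ = 1 ∨ τ = -1) → ∀ (H : ZMod n → ℂ) (A : (ZMod n)ˣ),
    (∀ b, H b ≠ 0 → ∃ u : (ZMod n)ˣ, u * u = 1 ∧ b = (u : ZMod n) * A) →
    (∀ χ : DirichletCharacter ℂ n, χ.IsPrimitive → χ (-1) = τ → ∑ b : ZMod n, H b * χ b = 0) →
    ∀ b, H (-b) = -τ * H b := by
  intro n
  induction n using Nat.strong_induction_on with
  | _ n ih =>
  intro _ hn5 τ hτ H A hsupp hH b
  classical
  have hn0 : n ≠ 0 := NeZero.ne n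
  by_cases hn1 : n = 1
  · subst hn1
    haveI : Subsingleton (ZMod 1) := ZMod.subsingleton_iff.mpr rfl
    rw [Subsingleton.elim (-b) b]
    rcases hτ with rfl | rfl
    · have key := hH 1 DirichletCharacter.isPrimitive_one_level_one
        (by rw [MulChar.one_apply (isUnit_of_subsingleton _)])
      rw [Fintype.sum_subsingleton _ b, MulChar.one_apply (isUnit_of_subsingleton _), mul_one] at key
      rw [key]; ring
    · ring
  obtain ⟨p, e, n₁, hp, he, hpn, hcop, rfl⟩ := exists_primePow_mul hn0 hn1
  haveI : NeZero (p ^ e) := ⟨pow_ne_zero e hp.ne_zero⟩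
  have hn₁0 : n₁ ≠ 0 := fun h0 ↦ hn0 (by rw [h0, mul_zero])
  haveI : NeZero n₁ := ⟨hn₁0⟩
  have hpN : p ∈ (p ^ e * n₁).primeFactors := by
    rw [Nat.mem_primeFactors]
    exact ⟨hp, dvd_mul_of_dvd_left (dvd_pow_self p (by omega)) n₁, hn0⟩
  have hp5 : 5 ≤ p := hn5 p hpN
  have hp2 : p ≠ 2 := by omega
  have hqodd : Odd (p ^ e) := (hp.odd_of_ne_two hp2).pow
  have hq1 : 1 < p ^ e := Nat.one_lt_pow (by omega) hp.one_lt
  have hq5 : 5 ≤ p ^ e := le_trans hp5 (Nat.le_self_pow (by omega) p)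
  have hn₁lt : n₁ < p ^ e * n₁ := lt_mul_left (Nat.pos_of_ne_zero hn₁0) hq1
  have hn₁5 : ∀ p' ∈ n₁.primeFactors, 5 ≤ p' := fun p' hp' ↦ hn5 p' (by
    rw [Nat.primeFactors_mul (NeZero.ne _) hn₁0]; exact mem_union_right _ hp')
  -- primitive characters of both parities mod `q = p^e`
  have hq12 : p ^ e ≠ 12 := fun h ↦ by rw [h] at hqodd; exact (by decide : ¬ Odd 12) hqodd
  have hq1' : p ^ e ≠ 1 := by omega
  have hq3 : p ^ e ≠ 3 := by omega
  have hq4 : p ^ e ≠ 4 := by omega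
  obtain ⟨ψo, hψo, hψop⟩ := exists_odd_isPrimitive (f := p ^ e) (Or.inl hqodd) hq1' hq12
  obtain ⟨ψe, hψe, hψep⟩ := exists_even_isPrimitive (f := p ^ e) (Or.inl hqodd) hq3 hq4
  -- the residues of `A`
  set a₁ : (ZMod (p ^ e))ˣ := Units.map (ZMod.castHom (dvd_mul_right (p ^ e) n₁) (ZMod (p ^ e))).toMonoidHom A
    with ha₁
  set A₁ : (ZMod n₁)ˣ := Units.map (ZMod.castHom (dvd_mul_left n₁ (p ^ e)) (ZMod n₁)).toMonoidHom A with hA₁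
  have ha₁v : (a₁ : ZMod (p ^ e)) = ZMod.castHom (dvd_mul_right (p ^ e) n₁) (ZMod (p ^ e)) A := rfl
  have hA₁v : (A₁ : ZMod n₁) = ZMod.castHom (dvd_mul_left n₁ (p ^ e)) (ZMod n₁) A := rfl
  -- support: residues mod `q` are `±a₁`, residues mod `n₁` lie on the orbit of `A₁`
  have hres : ∀ x, H x ≠ 0 →
      (ZMod.castHom (dvd_mul_right (p ^ e) n₁) (ZMod (p ^ e)) x = a₁ ∨
        ZMod.castHom (dvd_mul_right (p ^ e) n₁) (ZMod (p ^ e)) x = -a₁) ∧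
      ∃ u₁ : (ZMod n₁)ˣ, u₁ * u₁ = 1 ∧
        ZMod.castHom (dvd_mul_left n₁ (p ^ e)) (ZMod n₁) x = (u₁ : ZMod n₁) * A₁ := by
    intro x hx
    obtain ⟨u, hu, rfl⟩ := hsupp x hx
    constructor
    · set uq : (ZMod (p ^ e))ˣ := Units.map (ZMod.castHom (dvd_mul_right (p ^ e) n₁) (ZMod (p ^ e))).toMonoidHom u
      have huq : uq * uq = 1 := by rw [← map_mul, hu, map_one]
      rcases units_sq_eq_one_primePow hp hp2 he uq huq with h1 | h1
      · left
        rw [map_mul, ha₁v]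
        have : (uq : ZMod (p ^ e)) = 1 := by rw [h1, Units.val_one]
        rw [show (ZMod.castHom (dvd_mul_right (p ^ e) n₁) (ZMod (p ^ e))) (u : ZMod (p ^ e * n₁)) =
          (uq : ZMod (p ^ e)) from rfl, this, one_mul]
      · right
        rw [map_mul, ha₁v]
        have : (uq : ZMod (p ^ e)) = -1 := by rw [h1, Units.val_neg, Units.val_one]
        rw [show (ZMod.castHom (dvd_mul_right (p ^ e) n₁) (ZMod (p ^ e))) (u : ZMod (p ^ e * n₁)) =
          (uq : ZMod (p ^ e)) from rfl, this, neg_one_mul]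
    · refine ⟨Units.map (ZMod.castHom (dvd_mul_left n₁ (p ^ e)) (ZMod n₁)).toMonoidHom u, ?_, ?_⟩
      · rw [← map_mul, hu, map_one]
      · rw [map_mul]; rfl
  -- the two slices over `±a₁`
  set Hp : ZMod n₁ → ℂ := fun b₁ ↦ H ((ZMod.chineseRemainder hcop).symm (a₁, b₁)) +
    H ((ZMod.chineseRemainder hcop).symm (-(a₁ : ZMod (p ^ e)), b₁)) with hHp
  set Hm : ZMod n₁ → ℂ := fun b₁ ↦ H ((ZMod.chineseRemainder hcop).symm (a₁, b₁)) -
    H ((ZMod.chineseRemainder hcop).symm (-(a₁ : ZMod (p ^ e)), b₁)) with hHm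
  -- CRT bookkeeping
  have hcrt : ∀ (c : ZMod (p ^ e)) (b₁ : ZMod n₁),
      ZMod.castHom (dvd_mul_right (p ^ e) n₁) (ZMod (p ^ e)) ((ZMod.chineseRemainder hcop).symm (c, b₁)) = c ∧
      ZMod.castHom (dvd_mul_left n₁ (p ^ e)) (ZMod n₁) ((ZMod.chineseRemainder hcop).symm (c, b₁)) = b₁ := by
    intro c b₁
    have h1 : ZMod.chineseRemainder hcop ((ZMod.chineseRemainder hcop).symm (c, b₁)) = (c, b₁) :=
      RingEquiv.apply_symm_apply _ _
    have hfst : ∀ x : ZMod (p ^ e * n₁), (ZMod.chineseRemainder hcop x).1 =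
        ZMod.castHom (dvd_mul_right (p ^ e) n₁) (ZMod (p ^ e)) x := fun x ↦ by
      change ((ZMod.cast x : ZMod (p ^ e) × ZMod n₁)).1 = _
      rw [Prod.fst_zmod_cast, ZMod.castHom_apply]
    have hsnd : ∀ x : ZMod (p ^ e * n₁), (ZMod.chineseRemainder hcop x).2 =
        ZMod.castHom (dvd_mul_left n₁ (p ^ e)) (ZMod n₁) x := fun x ↦ by
      change ((ZMod.cast x : ZMod (p ^ e) × ZMod n₁)).2 = _
      rw [Prod.snd_zmod_cast, ZMod.castHom_apply]
    exact ⟨by rw [← hfst, h1], by rw [← hsnd, h1]⟩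
  have hcrt' : ∀ x : ZMod (p ^ e * n₁), (ZMod.chineseRemainder hcop).symm
      (ZMod.castHom (dvd_mul_right (p ^ e) n₁) (ZMod (p ^ e)) x,
        ZMod.castHom (dvd_mul_left n₁ (p ^ e)) (ZMod n₁) x) = x := by
    intro x
    have hfst : (ZMod.chineseRemainder hcop x).1 = ZMod.castHom (dvd_mul_right (p ^ e) n₁) (ZMod (p ^ e)) x := by
      change ((ZMod.cast x : ZMod (p ^ e) × ZMod n₁)).1 = _
      rw [Prod.fst_zmod_cast, ZMod.castHom_apply]
    have hsnd : (ZMod.chineseRemainder hcop x).2 = ZMod.castHom (dvd_mul_left n₁ (p ^ e)) (ZMod n₁) x := by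
      change ((ZMod.cast x : ZMod (p ^ e) × ZMod n₁)).2 = _
      rw [Prod.snd_zmod_cast, ZMod.castHom_apply]
    rw [← hfst, ← hsnd, Prod.mk.eta, RingEquiv.symm_apply_apply]
  have hne : (a₁ : ZMod (p ^ e)) ≠ -a₁ := by
    intro heq
    have hq2 : 2 < p ^ e := lt_of_lt_of_le (by omega) (Nat.le_self_pow (by omega) p)
    haveI : Fact (2 < p ^ e) := ⟨hq2⟩
    have h2 : (2 : ZMod (p ^ e)) * a₁ = 0 := by rw [two_mul]; nth_rewrite 2 [heq]; rw [add_neg_cancel]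
    have h2' : (2 : ZMod (p ^ e)) = 0 := by
      have := congrArg (· * ((a₁⁻¹ : (ZMod (p ^ e))ˣ) : ZMod (p ^ e))) h2
      simpa [mul_assoc] using this
    have hdvd : (p ^ e : ℕ) ∣ 2 := by
      rw [show (2 : ZMod (p ^ e)) = ((2 : ℕ) : ZMod (p ^ e)) by norm_cast] at h2'
      exact (ZMod.natCast_eq_zero_iff 2 (p ^ e)).mp h2'
    exact absurd (Nat.le_of_dvd Nat.two_pos hdvd) (by omega)
  -- expansion of `∑ H χ` for a product character `ψ ⊠ χ₂`
  have hexp : ∀ (ψ : DirichletCharacter ℂ (p ^ e)) (χ₂ : DirichletCharacter ℂ n₁),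
      ∑ x : ZMod (p ^ e * n₁), H x * (DirichletCharacter.changeLevel (dvd_mul_right (p ^ e) n₁) ψ *
        DirichletCharacter.changeLevel (dvd_mul_left n₁ (p ^ e)) χ₂) x =
      ψ a₁ * ∑ b₁ : ZMod n₁, (H ((ZMod.chineseRemainder hcop).symm (a₁, b₁)) +
        ψ (-1) * H ((ZMod.chineseRemainder hcop).symm (-(a₁ : ZMod (p ^ e)), b₁))) * χ₂ b₁ := by
    intro ψ χ₂
    haveI : NeZero (p ^ e * n₁) := ⟨hn0⟩
    rw [← Equiv.sum_comp (ZMod.chineseRemainder hcop).symm.toEquiv, Fintype.sum_prod_type]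
    have hterm : ∀ (c : ZMod (p ^ e)) (b₁ : ZMod n₁),
        H ((ZMod.chineseRemainder hcop).symm (c, b₁)) *
          (DirichletCharacter.changeLevel (dvd_mul_right (p ^ e) n₁) ψ *
            DirichletCharacter.changeLevel (dvd_mul_left n₁ (p ^ e)) χ₂) ((ZMod.chineseRemainder hcop).symm (c, b₁)) =
        if c = a₁ ∨ c = -a₁ then ψ c * (H ((ZMod.chineseRemainder hcop).symm (c, b₁)) * χ₂ b₁) else 0 := by
      intro c b₁
      by_cases hc : c = a₁ ∨ c = -a₁
      · rw [if_pos hc, prodChar_apply, (hcrt c b₁).1, (hcrt c b₁).2]; ring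
      · rw [if_neg hc]
        have h0 : H ((ZMod.chineseRemainder hcop).symm (c, b₁)) = 0 := by
          by_contra hne0
          have := (hres _ hne0).1
          rw [(hcrt c b₁).1] at this
          exact hc this
        rw [h0, zero_mul]
    simp only [RingEquiv.toEquiv_eq_coe, EquivLike.coe_coe]
    simp_rw [hterm]
    have hsum : ∀ c : ZMod (p ^ e), ∑ b₁ : ZMod n₁,
        (if c = a₁ ∨ c = -a₁ then ψ c * (H ((ZMod.chineseRemainder hcop).symm (c, b₁)) * χ₂ b₁) else 0) =
        if c = a₁ ∨ c = -a₁ then ψ c * ∑ b₁ : ZMod n₁, H ((ZMod.chineseRemainder hcop).symm (c, b₁)) * χ₂ b₁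
          else 0 := by
      intro c
      split_ifs
      · rw [Finset.mul_sum]
      · exact Finset.sum_const_zero
    simp_rw [hsum]
    rw [Finset.sum_ite, Finset.sum_const_zero, add_zero]
    have hfilter : (univ.filter fun c : ZMod (p ^ e) ↦ c = a₁ ∨ c = -a₁) =
        {(a₁ : ZMod (p ^ e)), -(a₁ : ZMod (p ^ e))} := by
      ext c; simp only [mem_filter, mem_univ, true_and, mem_insert, mem_singleton]
    rw [hfilter, Finset.sum_pair hne, show ψ (-(a₁ : ZMod (p ^ e))) = ψ (-1) * ψ a₁ by
      rw [← map_mul, neg_one_mul], Finset.mul_sum, Finset.mul_sum, Finset.mul_sum, ← Finset.sum_add_distrib]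
    refine Finset.sum_congr rfl fun b₁ _ ↦ ?_
    ring
  have hψa : ∀ ψ : DirichletCharacter ℂ (p ^ e), ψ a₁ ≠ 0 := fun ψ h0 ↦ by
    have := DirichletCharacter.unit_norm_eq_one ψ a₁
    rw [h0, norm_zero] at this
    exact zero_ne_one this
  -- `Hp` is orthogonal to the primitive characters mod `n₁` of parity `τ`
  have hHpnull : ∀ χ₂ : DirichletCharacter ℂ n₁, χ₂.IsPrimitive → χ₂ (-1) = τ →
      ∑ b₁ : ZMod n₁, Hp b₁ * χ₂ b₁ = 0 := by
    intro χ₂ hχ₂ hpar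
    have hprim := prodChar_isPrimitive hcop hψep hχ₂
    have hparity : (DirichletCharacter.changeLevel (dvd_mul_right (p ^ e) n₁) ψe *
        DirichletCharacter.changeLevel (dvd_mul_left n₁ (p ^ e)) χ₂) (-1) = τ := by
      rw [prodChar_neg_one, hψe, hpar, one_mul]
    have key := hH _ hprim hparity
    rw [hexp ψe χ₂, hψe] at key
    have := (mul_eq_zero.mp key).resolve_left (hψa ψe)
    rw [← this]
    exact Finset.sum_congr rfl fun b₁ _ ↦ by rw [hHp, one_mul]
  -- `Hm` is orthogonal to the primitive characters mod `n₁` of parity `-τ`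
  have hHmnull : ∀ χ₂ : DirichletCharacter ℂ n₁, χ₂.IsPrimitive → χ₂ (-1) = -τ →
      ∑ b₁ : ZMod n₁, Hm b₁ * χ₂ b₁ = 0 := by
    intro χ₂ hχ₂ hpar
    have hprim := prodChar_isPrimitive hcop hψop hχ₂
    have hparity : (DirichletCharacter.changeLevel (dvd_mul_right (p ^ e) n₁) ψo *
        DirichletCharacter.changeLevel (dvd_mul_left n₁ (p ^ e)) χ₂) (-1) = τ := by
      rw [prodChar_neg_one, hψo, hpar]; ring
    have key := hH _ hprim hparity
    rw [hexp ψo χ₂, hψo] at key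
    have := (mul_eq_zero.mp key).resolve_left (hψa ψo)
    rw [← this]
    exact Finset.sum_congr rfl fun b₁ _ ↦ by rw [hHm]; ring
  -- supports of the slices lie on the orbit of `A₁`
  have hsuppP : ∀ b₁, Hp b₁ ≠ 0 → ∃ u₁ : (ZMod n₁)ˣ, u₁ * u₁ = 1 ∧ b₁ = (u₁ : ZMod n₁) * A₁ := by
    intro b₁ hb
    have : H ((ZMod.chineseRemainder hcop).symm (a₁, b₁)) ≠ 0 ∨
        H ((ZMod.chineseRemainder hcop).symm (-(a₁ : ZMod (p ^ e)), b₁)) ≠ 0 := by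
      by_contra hcon
      rw [not_or, not_not, not_not] at hcon
      exact hb (by rw [hHp]; simp only [hcon.1, hcon.2, add_zero])
    rcases this with h | h
    · obtain ⟨u₁, hu₁, hb₁⟩ := (hres _ h).2
      exact ⟨u₁, hu₁, by rw [(hcrt _ b₁).2] at hb₁; exact hb₁⟩
    · obtain ⟨u₁, hu₁, hb₁⟩ := (hres _ h).2
      exact ⟨u₁, hu₁, by rw [(hcrt _ b₁).2] at hb₁; exact hb₁⟩
  have hsuppM : ∀ b₁, Hm b₁ ≠ 0 → ∃ u₁ : (ZMod n₁)ˣ, u₁ * u₁ = 1 ∧ b₁ = (u₁ : ZMod n₁) * A₁ := by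
    intro b₁ hb
    have : H ((ZMod.chineseRemainder hcop).symm (a₁, b₁)) ≠ 0 ∨
        H ((ZMod.chineseRemainder hcop).symm (-(a₁ : ZMod (p ^ e)), b₁)) ≠ 0 := by
      by_contra hcon
      rw [not_or, not_not, not_not] at hcon
      exact hb (by rw [hHm]; simp only [hcon.1, hcon.2, sub_zero])
    rcases this with h | h
    · obtain ⟨u₁, hu₁, hb₁⟩ := (hres _ h).2
      exact ⟨u₁, hu₁, by rw [(hcrt _ b₁).2] at hb₁; exact hb₁⟩
    · obtain ⟨u₁, hu₁, hb₁⟩ := (hres _ h).2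
      exact ⟨u₁, hu₁, by rw [(hcrt _ b₁).2] at hb₁; exact hb₁⟩
  -- induction hypothesis on the two slices
  have hτ' : (-τ = 1 ∨ -τ = -1) := by rcases hτ with rfl | rfl <;> norm_num
  have ihP := ih n₁ hn₁lt hn₁5 τ hτ Hp A₁ hsuppP hHpnull
  have ihM := ih n₁ hn₁lt hn₁5 (-τ) hτ' Hm A₁ hsuppM hHmnull
  -- assemble: write `b = crt⁻¹(c, b₁)`; off the fibres over `±a₁` both sides vanish
  set c := ZMod.castHom (dvd_mul_right (p ^ e) n₁) (ZMod (p ^ e)) b with hc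
  set b₁ := ZMod.castHom (dvd_mul_left n₁ (p ^ e)) (ZMod n₁) b with hb₁
  have hb : b = (ZMod.chineseRemainder hcop).symm (c, b₁) := (hcrt' b).symm
  have hnegb : -b = (ZMod.chineseRemainder hcop).symm (-c, -b₁) := by
    rw [hb, ← map_neg]; rfl
  by_cases hcase : c = a₁ ∨ c = -a₁
  · -- the four values `H(±a₁, ±b₁)` in terms of the slices
    have e1 : H ((ZMod.chineseRemainder hcop).symm (a₁, b₁)) = (Hp b₁ + Hm b₁) / 2 := by
      simp only [hHp, hHm]; ring
    have e2 : H ((ZMod.chineseRemainder hcop).symm (-(a₁ : ZMod (p ^ e)), b₁)) = (Hp b₁ - Hm b₁) / 2 := by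
      simp only [hHp, hHm]; ring
    have e3 : H ((ZMod.chineseRemainder hcop).symm (a₁, -b₁)) = (Hp (-b₁) + Hm (-b₁)) / 2 := by
      simp only [hHp, hHm]; ring
    have e4 : H ((ZMod.chineseRemainder hcop).symm (-(a₁ : ZMod (p ^ e)), -b₁)) = (Hp (-b₁) - Hm (-b₁)) / 2 := by
      simp only [hHp, hHm]; ring
    have hP := ihP b₁
    have hM := ihM b₁
    rcases hcase with hca | hca
    · rw [hnegb, hb, hca, e4, e1, hP, hM]; ring
    · rw [hnegb, hb, hca, neg_neg, e3, e2, hP, hM]; ring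
  · -- off the fibres: both values vanish
    have h0 : H b = 0 := by
      by_contra hne0
      exact hcase (hres b hne0).1
    have h0' : H (-b) = 0 := by
      by_contra hne0
      have := (hres (-b) hne0).1
      rw [map_neg, ← hc, neg_eq_iff_eq_neg, neg_inj] at this
      exact hcase this.symm
    rw [h0, h0', mul_zero]

end PairedNull

end Summit.HodgeConjecture.HodgeConjecture.Theorems.CancelByAnyClaimLattice

end
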